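import Summits.BirchSwinnertonDyer.Rank1Residual.X11b.Three.KolyvaginNonvanishing
import Literature.NumberTheory.EllipticCurves.SkinnerZhang2014.MultiplicativeIndivisibility
import Literature.NumberTheory.EllipticCurves.Rank1Residual.MultiplicativeThreeTowerProofs
import HarnessLib

/-!
# TYPED CONJECTURE Z₃ (cell `bsd-stepL`, seat `bsd-stepL-koly`; memo `koly/MEMO-v0.md` §6) —
# W. Zhang's Theorem 1.1 / Skinner–Zhang's Theorem 1.3 at `p = 3 ∥ N`, and its STEP-L consumer

FILED per the planner's ruling (TARGET.md v1.3 §1.2: "unproven conjectures live in our theories, not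
Literature"; `no_new_routes`: Z₃ is NOT a route item and NOT a Literature fact — it is landed as an
`@[conjecture] def` together with its consumer, on the pattern of
`ClassClosure.RelativeExceptionalLeadingTermAt` + `bsdp_three_of_splitThreeResidue_of_conjecture`).
HONEST FRAMING: `ZhangAtThree` is a hypothesis-shaped `Prop`; NOTHING asserts it; the theorem below
says only that IF it holds then STEP L (`X11b.IndexLowerBoundAt W 3 K y_K`) follows from the McCallum
fact — which is `Koly.indexLowerBoundAt_of_kolyvaginClass_one_ne_zero_of_mccallum` at `p = 3`. A
proof of Z₃ is the WORK G1–G4 of the memo (status: `koly/MEMO-v2-DRAFT.md`); nothing is booked.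

Statement Z₃ (memo §6): `E/ℚ` of conductor `N` with `3 ∥ N`; `K` imaginary quadratic with every
`ℓ ∣ N` split (so `3` splits; `(d_K, N) = 1`); (i) `ρ̄_{E,3}` onto; (ii) `3 ∤ v₃(Δ_min)` (E[3] not
finite at 3 — SZ14 (c)); (ii′) if `3` is split multiplicative, `ord₃ log₃ q_E = 1` (SZ14 (c), split
clause); (iii) ♠(2)₃: every multiplicative `ℓ ≠ 3` has `3 ∤ v_ℓ(Δ_min)`; (iv) ♠(3)₃: there is a
multiplicative `ℓ ≠ 3`; (v) no additive `ℓ` with `3 ∣ c_ℓ(E)` (Zhang Lemma 5.1 (2) at `p = 3`).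
THEN `c_1(n) ≠ 0 ∈ H¹(K, E[3])` for some `n ∈ Λ₃` (tree currency as in
`WZhang2014_exists_kolyvaginClass_one_ne_zero`). The architecture that would prove it is Zhang's
with UNIPOTENT-ADMISSIBLE auxiliary primes (memo §4, `UnipotentAdmissible.lean`) modulo the named
gaps G1–G4 (memo §5).
-/

noncomputable section

open scoped Classical

namespace Summit.BirchSwinnertonDyer.Rank1Residual.X11b.Three.Koly

open WeierstrassCurve Literature.NumberTheory.EllipticCurves
  Literature.NumberTheory.EllipticCurves.ModularForms

/-- **Conjecture Z₃ (typed; NOT asserted)** — Zhang 2014 Thm 1.1 / Skinner–Zhang 2014 Thm 1.3 moved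
to `p = 3 ∥ N` (memo `koly/MEMO-v0.md` §6). Binders: `W` globally minimal; `3 ∥ N`
(multiplicative reduction at 3); `ρ̄_{E,3}` onto; `3 ∤ v₃(Δ_min)`; split-3 `𝓛`-clause
`ord₃ log₃ q_E = 1` (every Tate parameter datum); ♠(2)₃, ♠(3)₃; no additive `ℓ` with `3 ∣ c_ℓ`
(rendered: `3 ∤ ∏_ℓ c_ℓ(E/ℚ)` — on the Z₃ locus the multiplicative and `ℓ = 3` factors are 3-units
by (ii), (iii), so this is exactly the additive condition; it also makes the locus a sub-atom of A1);
`K` imaginary quadratic, Heegner for `N_E`, `d_K ≠ -3`. Conclusion in the currency of the tree's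
Kolyvagin facts. CONJECTURE (hypothesis-shaped `Prop`, nothing asserted; cell bsd-stepL, seat koly).
[cite: WZhang2014, Thm. 1.1 (p. 195) with "p ≥ 5 ordinary, p ∤ N" replaced by "p = 3 ∥ N" — NOT printed at p = 3 (shape only; nothing asserted)]
[cite: McCallumLMS1991, §5 Cor. 5.6 (p. 310) — the consumer's bridge] -/
@[conjecture] def ZhangAtThree (W : WeierstrassCurve ℚ) [W.IsElliptic] [W.IsGloballyMinimal]
    [NeZero (W.conductorNorm ℤ)] (K : Type) [Field K] [NumberField K] : Prop :=
  W.HasMultiplicativeReductionAtPrime 3 →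
  W.HasSurjectiveModNGaloisRep 3 →
  ¬ 3 ∣ padicValInt 3 W.minimalDiscriminantInt →
  (W.HasSplitMultiplicativeReductionAtPrime 3 →
    ∀ D : TateParameterData W 3, (padicLog 3 D.q).valuation = 1) →
  (∀ (ℓ : ℕ) [Fact ℓ.Prime], ℓ ≠ 3 → W.HasMultiplicativeReductionAtPrime ℓ →
    ¬ 3 ∣ padicValInt ℓ W.minimalDiscriminantInt) →
  (∃ (ℓ : ℕ) (_ : Fact ℓ.Prime), ℓ ≠ 3 ∧ W.HasMultiplicativeReductionAtPrime ℓ) →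
  ¬ 3 ∣ W.tamagawaProduct →
  IsImaginaryQuadratic K → SatisfiesHeegnerHypothesis (W.conductorNorm ℤ) K →
  NumberField.discr K ≠ -3 →
  ∃ (Dt : ModularParametrizationData W (W.conductorNorm ℤ)) (β : ℤ) (ι : K →+* ℂ) (n : ℕ)
    (d : KolyvaginHeegnerData Dt β ι n),
    KolyvaginDescent.KolSupp (Zhang2014.IsKolyvaginPrime (W.conductorNorm ℤ) W K 3) n ∧
      d.kolyvaginClass Nat.prime_three 1 ≠ 0

/-- **Z₃ ⇒ STEP L at 3 for the paper-normalised Heegner point** (the `p = 3` instance of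
`indexLowerBoundAt_of_kolyvaginClass_one_ne_zero_of_mccallum`; McCallum's fact `hMc` with its
binders: non-CM, `d_K ∉ {−3, −4}`, `E(K)` of rank one with no 3-torsion, `Ш(E/K)` finite; its
tower-surjectivity binder is DISCHARGED here: `3 ∥ N` + `Surj(3)` ⇒ `surj(3ⁿ)` for all `n`, tree theorem
`Rank1Residual.surjective_pow_three_of_mult_of_tateLine`, Wuthrich 2014 Lemma 20). CONDITIONAL on `hMc`; `hZ3 : ZhangAtThree W K` is a HYPOTHESIS (open).
[cite: McCallumLMS1991, §5 Cor. 5.6 (p. 310)] [cite: Wuthrich2014, Lemma 20 (p. 399)] -/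
theorem exists_indexLowerBoundAt_three_of_zhangAtThree_of_mccallum
    (W : WeierstrassCurve ℚ) [W.IsElliptic] [W.IsGloballyMinimal] [NeZero (W.conductorNorm ℤ)]
    (K : Type) [Field K] [NumberField K]
    (hZ3 : ZhangAtThree W K) (hMc : McCallum1991_pow_dvd_card_sha_primary_of_certificate)
    (hmult : W.HasMultiplicativeReductionAtPrime 3) (hρ : W.HasSurjectiveModNGaloisRep 3)
    (hfin3 : ¬ 3 ∣ padicValInt 3 W.minimalDiscriminantInt)
    (hL : W.HasSplitMultiplicativeReductionAtPrime 3 →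
      ∀ D : TateParameterData W 3, (padicLog 3 D.q).valuation = 1)
    (hram : ∀ (ℓ : ℕ) [Fact ℓ.Prime], ℓ ≠ 3 → W.HasMultiplicativeReductionAtPrime ℓ →
      ¬ 3 ∣ padicValInt ℓ W.minimalDiscriminantInt)
    (hmult' : ∃ (ℓ : ℕ) (_ : Fact ℓ.Prime), ℓ ≠ 3 ∧ W.HasMultiplicativeReductionAtPrime ℓ)
    (htam : ¬ 3 ∣ W.tamagawaProduct)
    (hK : IsImaginaryQuadratic K) (hH : SatisfiesHeegnerHypothesis (W.conductorNorm ℤ) K)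
    (h3 : NumberField.discr K ≠ -3) (h4 : NumberField.discr K ≠ -4) (hCM : ¬ W.HasCM)
    (hrank : (W.baseChange K).mordellWeilRank = 1)
    (hiv : ∀ x : (W.baseChange K).toAffine.Point, 3 • x = 0 → x = 0)
    [Finite (W.baseChange K).sha] :
    ∃ (Dt : ModularParametrizationData W (W.conductorNorm ℤ)) (β : ℤ) (ι : K →+* ℂ),
      ∀ (d₁ : KolyvaginHeegnerData Dt β ι 1) (P : (W.baseChange K).toAffine.Point),
        d₁.toGeomPoints d₁.derivedPoint = toGeomPoints (W.baseChange K) P →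
        ¬ IsOfFinAddOrder P →
        ∀ (M₀ : ℕ), (∃ Q : (W.baseChange K).toAffine.Point, ((3 ^ M₀ : ℕ) : ℤ) • Q = P) →
          (¬ ∃ Q : (W.baseChange K).toAffine.Point, ((3 ^ (M₀ + 1) : ℕ) : ℤ) • Q = P) →
          IndexLowerBoundAt W 3 K P := by
  -- tower surjectivity at 3 is a THEOREM at a multiplicative 3 (Wuthrich 2014, Lemma 20; tree)
  have hsurj : ∀ m : ℕ, W.HasSurjectiveModNGaloisRep (3 ^ m : ℕ) :=
    Rank1Residual.surjective_pow_three_of_mult_of_tateLine W hmult hρ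
  obtain ⟨Dt, β, ι, n, d, hn, hne⟩ := hZ3 hmult hρ hfin3 hL (fun ℓ _ h hm ↦ hram ℓ h hm) hmult' htam
    hK hH h3
  exact ⟨Dt, β, ι, fun d₁ P hP hPinf M₀ hdiv hndiv ↦
    indexLowerBoundAt_of_kolyvaginClass_one_ne_zero_of_mccallum W K hMc hCM hK h3 h4 hH 3 (by norm_num)
      hsurj Dt β ι d₁ P hP hPinf hrank hiv hdiv hndiv d hn hne⟩

end Summit.BirchSwinnertonDyer.Rank1Residual.X11b.Three.Koly

end
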